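import Summits.Ventures.PercRepro.S1RowTen
import Summits.Ventures.PercRepro.S1CellNineReducedP
import Summits.Ventures.PercRepro.S1KillCellNineEleven
import Summits.Ventures.PercRepro.S1KillCellNineTwelve
import Summits.Ventures.PercRepro.S1CellNineFourteen
import Summits.Ventures.PercRepro.S1CellNineFifteen
import Summits.Ventures.PercRepro.S1CellNineSixteen

/-!
# PercRepro — END `9` MODULO THE SIX CORE CELLS `(9, 5)` … `(9, 10)` (p2, gen 26; SUBCLAIM-S1 §6.10)

The frame of the row `p = 9` assembled in advance: the core of rank `9` at corank `11 ≤ d ≤ 17` by the seven named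
cells of the tree, `18 ≤ d ≤ 400` by the `cellOK8` tables (kernel; `cellOK8 9 d` is FALSE for `d ≤ 17`), `d ≥ 401`
by the tail through `C(n, 8)` (the key constant has ratio `1.147` only, so the step `n ≤ 2 (n − 7)` of END 10 / 11
is replaced by `403 n ≤ 410 (n − 7)`), and the coranks `5 ≤ d ≤ 10` — the six open cells of the map — as
HYPOTHESES. With the three conditional cells of the tree, the row reduces to `(P9,10)`, `(P9,9)`, `(P9,8)` and the
three small cells `(9, 5)`, `(9, 6)`, `(9, 7)`: when those land, `c025_four_nine (9 ≤ p) : RLS M p 4` is one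
application and the window of record moves to `7 ≤ p ≤ 8`.

* `pow_le_factorial_mul_choose_eight`, `tailM9`, `cellOK8_of_tail9`, `table_9_18_100` … `table_9_18_400`;
* **`c025_core_four_nine_of_cells`** — the core of rank `9` modulo the six cells;
* **`c025_four_nine_of_cells`** — level `4` at every `p ≥ 9` modulo the six cells;
* **`c025_four_nine_of_caps`** — the same modulo `(P9,10)`, `(P9,9)`, `(P9,8)` and the cells `(9, 5)`, `(9, 6)`, `(9, 7)`.
Axioms: standard.
-/

open scoped Matroid

namespace PercRepro

namespace S1

open Set

variable {α : Type}

/-- `8! · C(n, 8) ≥ (n − 7)^8`. -/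
theorem pow_le_factorial_mul_choose_eight (n : ℕ) : (n + 1 - 8) ^ 8 ≤ Nat.factorial 8 * n.choose 8 := by
  rw [← Nat.descFactorial_eq_factorial_mul_choose]
  exact Nat.pow_sub_le_descFactorial n 8

/-- The tail inequalities (flat-profile form at `d ≥ 8`, per-flat `U`, `R₃` at `7/5`) for `p = 9`, `d ≥ 401`: the
`Y`-side keeps the single binomial `C(n, 8)`, and the step `n ≤ (410/403)·(n − 7)` replaces the crude `n ≤ 2 (n − 7)`
(the key constant has ratio `1.147` only). -/
theorem tailM9 (p d : ℕ) (hp : 9 ≤ p) (hp' : p ≤ 9) (hd : 401 ≤ d) :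
    10584 * (min (d * (d + 1) / 2) ((d * d + 6 - 3 * d) / 2) * (p + d - 3) + min (min ((d + 3).choose 4) (d * (d + 1) * (d + 2) / 3)) (fourCircuitBound d)) +
        (RSK 10 * (min (d * (d + 1) / 2) ((d * d + 6 - 3 * d) / 2) * (p + d - 3).choose 2 + min (min ((d + 3).choose 4) (d * (d + 1) * (d + 2) / 3)) (fourCircuitBound d) * (p + d - 4) + (d + 4).choose 5) +
          (RBK 10 - RSK 10) * (min (d * (d + 1) / 2) ((d * d + 6 - 3 * d) / 2) * (min (5 * d) (p + d) - 3).choose 2 + min (min ((d + 3).choose 4) (d * (d + 1) * (d + 2) / 3)) (fourCircuitBound d) * (min (5 * d) (p + d) - 4) + (d + 4).choose 5)) ≤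
      7560 * ∑ j ∈ Finset.Ico 5 p, (p + d).choose j ∧
    (2 ^ (p + 4) - 2 * ∑ u ∈ Finset.range 5, (p + 4).choose u) *
        (7560 * (p + d).choose 4 +
          (RSK d * (p + d - 3).choose 2 + (RBK d - RSK d) * (min (5 * d) (p + d) - 3).choose 2 - 7560 * (p + d - 3)) *
            min (d * (d + 1) / 2) ((d * d + 6 - 3 * d) / 2) +
          (RSK d * (p + d - 4) + (RBK d - RSK d) * (min (5 * d) (p + d) - 4) - 7560) *
            min (min ((d + 3).choose 4) (d * (d + 1) * (d + 2) / 3)) (fourCircuitBound d) +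
          (RSK d + (RBK d - RSK d)) * (d + 4).choose 5) +
      (p + 4).choose 4 *
        (10584 * (min (d * (d + 1) / 2) ((d * d + 6 - 3 * d) / 2) * (p + d - 3) + min (min ((d + 3).choose 4) (d * (d + 1) * (d + 2) / 3)) (fourCircuitBound d)) +
          (RSK 10 * (min (d * (d + 1) / 2) ((d * d + 6 - 3 * d) / 2) * (p + d - 3).choose 2 + min (min ((d + 3).choose 4) (d * (d + 1) * (d + 2) / 3)) (fourCircuitBound d) * (p + d - 4) + (d + 4).choose 5) +
            (RBK 10 - RSK 10) * (min (d * (d + 1) / 2) ((d * d + 6 - 3 * d) / 2) * (min (5 * d) (p + d) - 3).choose 2 + min (min ((d + 3).choose 4) (d * (d + 1) * (d + 2) / 3)) (fourCircuitBound d) * (min (5 * d) (p + d) - 4) + (d + 4).choose 5))) ≤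
      (p + 4).choose 4 * (7560 * ∑ j ∈ Finset.Ico 5 p, (p + d).choose j) := by
  set n := p + d with hn
  set m := min (5 * d) n with hm
  set s4 := min (min ((d + 3).choose 4) (d * (d + 1) * (d + 2) / 3)) (fourCircuitBound d) with hs4def
  -- the crude bounds
  set s3 := min (d * (d + 1) / 2) ((d * d + 6 - 3 * d) / 2) with hs3def
  have hs3 : s3 ≤ n * n := by
    have h0 : s3 ≤ d * (d + 1) / 2 := min_le_left _ _
    have : d * (d + 1) / 2 ≤ d * (d + 1) := Nat.div_le_self _ _
    have : d * (d + 1) ≤ n * n := Nat.mul_le_mul (by omega) (by omega)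
    omega
  have hs4 : s4 ≤ n ^ 4 :=
    ((min_le_left _ _).trans (min_le_left _ _)).trans ((choose_le_pow' _ _).trans (Nat.pow_le_pow_left (by omega) 4))
  have hs5 : (d + 4).choose 5 ≤ n ^ 5 := (choose_le_pow' _ _).trans (Nat.pow_le_pow_left (by omega) 5)
  have hc2 : (n - 3).choose 2 ≤ n ^ 2 := (choose_le_pow' _ _).trans (Nat.pow_le_pow_left (by omega) 2)
  have hc4 : n.choose 4 ≤ n ^ 4 := choose_le_pow' _ _
  have hm5 : m ≤ 5 * n := (min_le_left _ _).trans (by omega)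
  have hm4 : m - 4 ≤ 5 * n := by omega
  have hcm : (m - 3).choose 2 ≤ 25 * n ^ 2 := by
    have h1 : (m - 3).choose 2 ≤ (m - 3) ^ 2 := choose_le_pow' _ _
    have h2 : (m - 3) ^ 2 ≤ (5 * n) ^ 2 := Nat.pow_le_pow_left (by omega) 2
    have h3 : (5 * n) ^ 2 = 25 * n ^ 2 := by ring
    omega
  have hn1 : 1 ≤ n := by omega
  have hn45 : n ^ 4 ≤ n ^ 5 := Nat.pow_le_pow_right hn1 (by norm_num)
  have hn25 : n ^ 2 ≤ n ^ 5 := Nat.pow_le_pow_right hn1 (by norm_num)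
  have hnn : n * n = n ^ 2 := by ring
  have hpiAll : s3 * (n - 3).choose 2 + s4 * (n - 4) + (d + 4).choose 5 ≤ 3 * n ^ 5 := by
    have h1 : s3 * (n - 3).choose 2 ≤ n ^ 2 * n ^ 2 := Nat.mul_le_mul (by rw [← hnn]; exact hs3) hc2
    have h2 : s4 * (n - 4) ≤ n ^ 4 * n := Nat.mul_le_mul hs4 (by omega)
    have h3 : n ^ 2 * n ^ 2 = n ^ 4 := by ring
    have h4 : n ^ 4 * n = n ^ 5 := by ring
    omega
  have hpiS0 : s3 * (m - 3).choose 2 + s4 * (m - 4) + (d + 4).choose 5 ≤ 31 * n ^ 5 := by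
    have h1 : s3 * (m - 3).choose 2 ≤ n ^ 2 * (25 * n ^ 2) := Nat.mul_le_mul (by rw [← hnn]; exact hs3) hcm
    have h2 : s4 * (m - 4) ≤ n ^ 4 * (5 * n) := Nat.mul_le_mul hs4 hm4
    have h3 : n ^ 2 * (25 * n ^ 2) = 25 * n ^ 4 := by ring
    have h4 : n ^ 4 * (5 * n) = 5 * n ^ 5 := by ring
    omega
  have hR3 : 10584 * (s3 * (n - 3) + s4) ≤ 21168 * n ^ 5 := by
    have h1 : s3 * (n - 3) ≤ n ^ 2 * n := Nat.mul_le_mul (by rw [← hnn]; exact hs3) (by omega)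
    have h2 : n ^ 2 * n = n ^ 3 := by ring
    have h3 : n ^ 3 ≤ n ^ 5 := Nat.pow_le_pow_right hn1 (by norm_num)
    omega
  have hRS := RSK_le d
  have hRB : RBK d - RSK d ≤ 24930 := (Nat.sub_le _ _).trans (RBK_le d)
  have hRS10 : RSK 10 = 11592 := by decide
  have hRB10 : RBK 10 - RSK 10 = 13338 := by decide
  set piAll := s3 * (n - 3).choose 2 + s4 * (n - 4) + (d + 4).choose 5 with hpiAll_def
  set piS0 := s3 * (m - 3).choose 2 + s4 * (m - 4) + (d + 4).choose 5 with hpiS0_def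
  set A3 := RSK d * (n - 3).choose 2 + (RBK d - RSK d) * (m - 3).choose 2 with hA3
  set A4 := RSK d * (n - 4) + (RBK d - RSK d) * (m - 4) with hA4
  have hA3le : A3 ≤ 11592 * n ^ 2 + 24930 * (25 * n ^ 2) := by
    rw [hA3]
    exact Nat.add_le_add (Nat.mul_le_mul hRS hc2) (Nat.mul_le_mul hRB hcm)
  have hA4le : A4 ≤ 11592 * n + 24930 * (5 * n) := by
    rw [hA4]
    exact Nat.add_le_add (Nat.mul_le_mul hRS (by omega)) (Nat.mul_le_mul hRB hm4)
  have hc3 : A3 - 7560 * (n - 3) ≤ A3 := Nat.sub_le _ _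
  have hc4' : A4 - 7560 ≤ A4 := Nat.sub_le _ _
  have hc5 : RSK d + (RBK d - RSK d) ≤ 36522 := by omega
  have hU : 7560 * n.choose 4 + (A3 - 7560 * (n - 3)) * s3 + (A4 - 7560) * s4 +
      (RSK d + (RBK d - RSK d)) * (d + 4).choose 5 ≤ 815166 * n ^ 5 := by
    have h1 : (A3 - 7560 * (n - 3)) * s3 ≤ (11592 * n ^ 2 + 24930 * (25 * n ^ 2)) * (n * n) :=
      Nat.mul_le_mul (hc3.trans hA3le) hs3
    have h2 : (A4 - 7560) * s4 ≤ (11592 * n + 24930 * (5 * n)) * n ^ 4 :=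
      Nat.mul_le_mul (hc4'.trans hA4le) hs4
    have h3 : (RSK d + (RBK d - RSK d)) * (d + 4).choose 5 ≤ 36522 * n ^ 5 := Nat.mul_le_mul hc5 hs5
    have h4 : 7560 * n.choose 4 ≤ 7560 * n ^ 5 := Nat.mul_le_mul_left _ (hc4.trans hn45)
    have e1 : (11592 * n ^ 2 + 24930 * (25 * n ^ 2)) * (n * n) = 634842 * n ^ 4 := by ring
    have e2 : (11592 * n + 24930 * (5 * n)) * n ^ 4 = 136242 * n ^ 5 := by ring
    have h5 : 634842 * n ^ 4 ≤ 634842 * n ^ 5 := Nat.mul_le_mul_left _ hn45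
    omega
  have hR4 : RSK 10 * piAll + (RBK 10 - RSK 10) * piS0 ≤ 448254 * n ^ 5 := by
    rw [hRB10, hRS10]
    have h1 : 11592 * piAll ≤ 11592 * (3 * n ^ 5) := Nat.mul_le_mul_left _ hpiAll
    have h2 : 13338 * piS0 ≤ 13338 * (31 * n ^ 5) := Nat.mul_le_mul_left _ hpiS0
    omega
  -- the `Y`-side: one binomial suffices
  have hY : 7560 * n.choose 8 ≤ 7560 * ∑ j ∈ Finset.Ico 5 p, n.choose j := by
    apply Nat.mul_le_mul_left
    exact Finset.single_le_sum (f := fun j => n.choose j) (fun _ _ => Nat.zero_le _)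
      (Finset.mem_Ico.2 ⟨by norm_num, by omega⟩)
  have hdesc := pow_le_factorial_mul_choose_eight n
  have hn8 : n + 1 - 8 = n - 7 := by omega
  rw [hn8] at hdesc
  have hfact : Nat.factorial 8 = 40320 := by decide
  rw [hfact] at hdesc
  -- `403 n ≤ 410 (n − 7)` (n ≥ 410), `n − 7 ≥ 403`
  have hmn : 403 ^ 5 * n ^ 5 ≤ 410 ^ 5 * (n - 7) ^ 5 := by
    have h1 : 403 * n ≤ 410 * (n - 7) := by omega
    have h2 : (403 * n) ^ 5 ≤ (410 * (n - 7)) ^ 5 := Nat.pow_le_pow_left h1 5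
    have h3 : (403 * n) ^ 5 = 403 ^ 5 * n ^ 5 := by ring
    have h4 : (410 * (n - 7)) ^ 5 = 410 ^ 5 * (n - 7) ^ 5 := by ring
    omega
  have h403 : 403 ^ 3 ≤ (n - 7) ^ 3 := Nat.pow_le_pow_left (by omega) 3
  have hsplit : (n - 7) ^ 8 = (n - 7) ^ 5 * (n - 7) ^ 3 := by ring
  -- `Φ`'s numerator and denominator
  have hphiNum : 2 ^ (p + 4) - 2 * ∑ u ∈ Finset.range 5, (p + 4).choose u ≤ 8192 := by
    have h1 : 2 ^ (p + 4) ≤ 2 ^ 13 := Nat.pow_le_pow_right (by norm_num) (by omega)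
    have h2 : (2 : ℕ) ^ 13 = 8192 := by norm_num
    omega
  have hDenU : (p + 4).choose 4 ≤ 715 := by
    have h9 : p = 9 := by omega
    subst h9; decide
  have hDenL : 715 ≤ (p + 4).choose 4 := by
    have h9 : p = 9 := by omega
    subst h9; decide
  -- the key numeric inequality
  obtain ⟨K, hK⟩ : ∃ K : ℕ, K = 8192 * 815166 + 715 * (21168 + 448254) := ⟨_, rfl⟩
  have hkey : K * 40320 * 410 ^ 5 ≤ 715 * 7560 * 403 ^ 5 * 403 ^ 3 := by rw [hK]; norm_num
  -- `K · n^5 ≤ 715 · 7560 · C(n, 8)`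
  have hYbig : K * n ^ 5 ≤ 715 * (7560 * n.choose 8) := by
    have h1 : K * n ^ 5 * (40320 * 403 ^ 5) ≤ 715 * 7560 * 403 ^ 5 * ((n - 7) ^ 5 * (n - 7) ^ 3) := by
      calc K * n ^ 5 * (40320 * 403 ^ 5)
          = (K * 40320) * (403 ^ 5 * n ^ 5) := by ring
        _ ≤ (K * 40320) * (410 ^ 5 * (n - 7) ^ 5) := Nat.mul_le_mul_left _ hmn
        _ = (K * 40320 * 410 ^ 5) * (n - 7) ^ 5 := by ring
        _ ≤ (715 * 7560 * 403 ^ 5 * 403 ^ 3) * (n - 7) ^ 5 := Nat.mul_le_mul_right _ hkey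
        _ ≤ (715 * 7560 * 403 ^ 5 * (n - 7) ^ 3) * (n - 7) ^ 5 := by gcongr
        _ = 715 * 7560 * 403 ^ 5 * ((n - 7) ^ 5 * (n - 7) ^ 3) := by ring
    rw [← hsplit] at h1
    have h2 : 715 * 7560 * 403 ^ 5 * (n - 7) ^ 8 ≤ 715 * 7560 * 403 ^ 5 * (40320 * n.choose 8) :=
      Nat.mul_le_mul_left _ hdesc
    have h3 : K * n ^ 5 * (40320 * 403 ^ 5) ≤ 715 * (7560 * n.choose 8) * (40320 * 403 ^ 5) := by
      calc _ ≤ 715 * 7560 * 403 ^ 5 * (40320 * n.choose 8) := h1.trans h2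
        _ = 715 * (7560 * n.choose 8) * (40320 * 403 ^ 5) := by ring
    exact Nat.le_of_mul_le_mul_right h3 (by norm_num)
  have hR34 : 10584 * (s3 * (n - 3) + s4) + (RSK 10 * piAll + (RBK 10 - RSK 10) * piS0) ≤
      (21168 + 448254) * n ^ 5 := by omega
  constructor
  · -- (I1): `R₃ + R₄ ≤ Ysum`
    have h2 : (21168 + 448254) * n ^ 5 ≤ 7560 * n.choose 8 := by
      have h5 : 715 * ((21168 + 448254) * n ^ 5) ≤ 715 * (7560 * n.choose 8) := by
        calc 715 * ((21168 + 448254) * n ^ 5) = (715 * (21168 + 448254)) * n ^ 5 := by ring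
          _ ≤ K * n ^ 5 := Nat.mul_le_mul_right _ (by rw [hK]; norm_num)
          _ ≤ _ := hYbig
      exact Nat.le_of_mul_le_mul_left h5 (by norm_num)
    exact hR34.trans (h2.trans hY)
  · -- (I2)
    have hL : (2 ^ (p + 4) - 2 * ∑ u ∈ Finset.range 5, (p + 4).choose u) *
        (7560 * n.choose 4 + (A3 - 7560 * (n - 3)) * s3 + (A4 - 7560) * s4 + (RSK d + (RBK d - RSK d)) * (d + 4).choose 5) +
        (p + 4).choose 4 * (10584 * (s3 * (n - 3) + s4) + (RSK 10 * piAll + (RBK 10 - RSK 10) * piS0)) ≤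
        K * n ^ 5 := by
      have h1 := Nat.mul_le_mul hphiNum hU
      have h2 : (p + 4).choose 4 * (10584 * (s3 * (n - 3) + s4) + (RSK 10 * piAll + (RBK 10 - RSK 10) * piS0)) ≤
          715 * ((21168 + 448254) * n ^ 5) := Nat.mul_le_mul hDenU hR34
      have h3 : 8192 * (815166 * n ^ 5) + 715 * ((21168 + 448254) * n ^ 5) = K * n ^ 5 := by rw [hK]; ring
      omega
    have hR : 715 * (7560 * n.choose 8) ≤ (p + 4).choose 4 * (7560 * ∑ j ∈ Finset.Ico 5 p, n.choose j) :=
      Nat.mul_le_mul hDenL hY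
    exact hL.trans (hYbig.trans hR)

/-- **`cellOK8 9 d` holds for every `d ≥ 401`.** -/
theorem cellOK8_of_tail9 (d : ℕ) (hd : 401 ≤ d) : cellOK8 9 d = true := by
  obtain ⟨h1, h2⟩ := tailM9 9 d (le_refl _) (le_refl _) hd
  exact cellOK8_of_tail_ineq 9 d (by omega) h1 h2

/-- The cells `(9, d)` for `18 ≤ d ≤ 100` (`cellOK8`, kernel). -/
theorem table_9_18_100 : ∀ d < 101, 18 ≤ d → cellOK8 9 d = true := by
  decide +kernel

/-- The cells `(9, d)` for `101 ≤ d ≤ 200` (`cellOK8`, kernel). -/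
theorem table_9_101_200 : ∀ d < 201, 101 ≤ d → cellOK8 9 d = true := by
  decide +kernel

/-- The cells `(9, d)` for `201 ≤ d ≤ 300` (`cellOK8`, kernel). -/
theorem table_9_201_300 : ∀ d < 301, 201 ≤ d → cellOK8 9 d = true := by
  decide +kernel

/-- The cells `(9, d)` for `301 ≤ d ≤ 400` (`cellOK8`, kernel). -/
theorem table_9_301_400 : ∀ d < 401, 301 ≤ d → cellOK8 9 d = true := by
  decide +kernel

/-- **THE ROW-`9` TABLE**: `cellOK8 9 d` for every `18 ≤ d ≤ 400`. -/
theorem table_9_18_400 : ∀ d < 401, 18 ≤ d → cellOK8 9 d = true := by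
  intro d hd hd18
  rcases Nat.lt_or_ge d 101 with h' | h'
  · exact table_9_18_100 d h' hd18
  rcases Nat.lt_or_ge d 201 with h'' | h''
  · exact table_9_101_200 d h'' h'
  rcases Nat.lt_or_ge d 301 with h''' | h'''
  · exact table_9_201_300 d h''' h''
  · exact table_9_301_400 d hd h'''

/-- The shape of a core cell of rank `9` and corank `d`, as a hypothesis. -/
def CellNine (d : ℕ) : Prop := ∀ (M : Matroid α) [M.Finite], M.eRank = (9 : ℕ) → M.E.ncard = 9 + d →
  (∀ e ∈ M.E, ∃ A ⊆ M.E \ {e}, e ∉ M.closure A ∧ e ∉ M.closure ((M.E \ {e}) \ A)) → ThmN.RLS M 9 4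

/-- **THE CORE OF RANK `9`** at every corank `d ≥ 5`, modulo the six cells `(9, 5)` … `(9, 10)`. -/
theorem c025_core_four_nine_of_cells (h5 : CellNine (α := α) 5) (h6 : CellNine (α := α) 6)
    (h7 : CellNine (α := α) 7) (h8 : CellNine (α := α) 8) (h9 : CellNine (α := α) 9) (h10 : CellNine (α := α) 10)
    (M : Matroid α) [M.Finite] (hR : M.eRank = (9 : ℕ)) (hbig : 9 + 4 < M.E.ncard)
    (hfree : ∀ e ∈ M.E, ∃ A ⊆ M.E \ {e}, e ∉ M.closure A ∧ e ∉ M.closure ((M.E \ {e}) \ A)) :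
    ThmN.RLS M 9 4 := by
  set d := M.E.ncard - 9 with hd
  have hn : M.E.ncard = 9 + d := by omega
  rcases Nat.lt_or_ge d 6 with h5' | h6'
  · exact h5 M hR (by omega) hfree
  rcases Nat.lt_or_ge d 7 with h6'' | h7'
  · exact h6 M hR (by omega) hfree
  rcases Nat.lt_or_ge d 8 with h7'' | h8'
  · exact h7 M hR (by omega) hfree
  rcases Nat.lt_or_ge d 9 with h8'' | h9'
  · exact h8 M hR (by omega) hfree
  rcases Nat.lt_or_ge d 10 with h9'' | h10'
  · exact h9 M hR (by omega) hfree
  rcases Nat.lt_or_ge d 11 with h10'' | h11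
  · exact h10 M hR (by omega) hfree
  rcases Nat.lt_or_ge d 12 with h11' | h12
  · exact c025_core_nine_eleven M hR (by omega) hfree
  rcases Nat.lt_or_ge d 13 with h12' | h13
  · exact c025_core_nine_twelve M hR (by omega) hfree
  rcases Nat.lt_or_ge d 14 with h13' | h14
  · exact c025_core_nine_thirteen M hR (by omega) hfree
  rcases Nat.lt_or_ge d 15 with h14' | h15
  · exact c025_core_nine_fourteen M hR (by omega) hfree
  rcases Nat.lt_or_ge d 16 with h15' | h16
  · exact c025_core_nine_fifteen M hR (by omega) hfree
  rcases Nat.lt_or_ge d 17 with h16' | h17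
  · exact c025_core_nine_sixteen M hR (by omega) hfree
  rcases Nat.lt_or_ge d 18 with h17' | h18
  · exact c025_core_nine_seventeen M hR (by omega) hfree
  rcases Nat.lt_or_ge d 401 with h401 | h401
  · exact rls_of_cellOK8 M 9 d (by omega) hR hn hfree (by norm_num) (table_9_18_400 d h401 h18)
  · exact rls_of_cellOK8 M 9 d (by omega) hR hn hfree (by norm_num) (cellOK8_of_tail9 d h401)

/-- **LEVEL `4` AT RANK `9`** modulo the six cells (the fixed-rank frame): for every finite matroid on `α`. -/
theorem c025_four_nine_fixed_of_cells (h5 : CellNine (α := α) 5) (h6 : CellNine (α := α) 6)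
    (h7 : CellNine (α := α) 7) (h8 : CellNine (α := α) 8) (h9 : CellNine (α := α) 9) (h10 : CellNine (α := α) 10)
    (M : Matroid α) [M.Finite] : ThmN.RLS M 9 4 := by
  refine rls_succ_fixed (α := α) 3 4 9 (by omega) ?_ ?_ ?_ M
  · intro M' _
    exact SevenThree.c025_three_all M' 8 (by omega)
  · intro M' _ hn
    rcases Nat.lt_or_ge M'.E.ncard (9 + 4) with h | h
    · exact ThmN.RLS_of_ncard_lt M' h
    · exact ThmN.RLS_of_ncard_eq M' (by omega)
  · intro M' _ hR hbig hfree
    exact c025_core_four_nine_of_cells h5 h6 h7 h8 h9 h10 M' hR hbig hfree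

/-- **C-025 AT LEVEL `4` FOR EVERY `p ≥ 9`, MODULO THE SIX CELLS**: with them the window of record reads
`7 ≤ p ≤ 8`. -/
theorem c025_four_nine_of_cells (h5 : CellNine (α := α) 5) (h6 : CellNine (α := α) 6)
    (h7 : CellNine (α := α) 7) (h8 : CellNine (α := α) 8) (h9 : CellNine (α := α) 9) (h10 : CellNine (α := α) 10)
    (M : Matroid α) [M.Finite] (p : ℕ) (hp : 9 ≤ p) : ThmN.RLS M p 4 := by
  rcases Nat.lt_or_ge p 10 with h | h
  · have hp9 : p = 9 := by omega
    subst hp9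
    exact c025_four_nine_fixed_of_cells h5 h6 h7 h8 h9 h10 M
  · exact c025_four_ten M p h

/-- **C-025 AT LEVEL `4` FOR EVERY `p ≥ 9`, MODULO THE CAPS AND THE THREE SMALL CELLS**: `(P9,10)` at `t ≥ 18`,
`(P9,9)` at `t ≥ 9`, `(P9,8)` on `17` points at `t ≥ 1` and on `16` points at `t ≥ 10`, and the cells `(9, 5)`,
`(9, 6)`, `(9, 7)`. -/
theorem c025_four_nine_of_caps (h5 : CellNine (α := α) 5) (h6 : CellNine (α := α) 6) (h7 : CellNine (α := α) 7)
    (hcap17 : ∀ (N : Matroid α) [N.Finite],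
      (∀ e ∈ N.E, ∃ A ⊆ N.E \ {e}, e ∉ N.closure A ∧ e ∉ N.closure ((N.E \ {e}) \ A)) →
      N.E.encard = N.eRank + ((8 : ℕ) : ℕ∞) → N.E.ncard = 17 → N.coloops = ∅ →
      ∀ t, 1 ≤ t → {C : Set α | N.IsCircuit C ∧ C.ncard = 3}.ncard = t →
      {C : Set α | N.IsCircuit C ∧ C.ncard = 4}.ncard ≤ capNineEight17 t)
    (hcap16 : ∀ (N : Matroid α) [N.Finite],
      (∀ e ∈ N.E, ∃ A ⊆ N.E \ {e}, e ∉ N.closure A ∧ e ∉ N.closure ((N.E \ {e}) \ A)) →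
      N.E.encard = N.eRank + ((8 : ℕ) : ℕ∞) → N.E.ncard = 16 → N.coloops = ∅ →
      ∀ t, 10 ≤ t → {C : Set α | N.IsCircuit C ∧ C.ncard = 3}.ncard = t →
      {C : Set α | N.IsCircuit C ∧ C.ncard = 4}.ncard ≤ capNineEight16 t)
    (hcap9 : ∀ (N : Matroid α) [N.Finite],
      (∀ e ∈ N.E, ∃ A ⊆ N.E \ {e}, e ∉ N.closure A ∧ e ∉ N.closure ((N.E \ {e}) \ A)) →
      N.E.encard = N.eRank + ((9 : ℕ) : ℕ∞) → N.E.ncard = 18 → N.coloops = ∅ →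
      ∀ t, 9 ≤ t → {C : Set α | N.IsCircuit C ∧ C.ncard = 3}.ncard = t →
      {C : Set α | N.IsCircuit C ∧ C.ncard = 4}.ncard ≤ capNineNineT t)
    (hcap10 : ∀ (N : Matroid α) [N.Finite],
      (∀ e ∈ N.E, ∃ A ⊆ N.E \ {e}, e ∉ N.closure A ∧ e ∉ N.closure ((N.E \ {e}) \ A)) →
      N.E.encard = N.eRank + ((10 : ℕ) : ℕ∞) → N.E.ncard = 19 → N.coloops = ∅ →
      ∀ t, 18 ≤ t → {C : Set α | N.IsCircuit C ∧ C.ncard = 3}.ncard = t →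
      {C : Set α | N.IsCircuit C ∧ C.ncard = 4}.ncard ≤ 164 - 8 * (t - 14))
    (M : Matroid α) [M.Finite] (p : ℕ) (hp : 9 ≤ p) : ThmN.RLS M p 4 :=
  c025_four_nine_of_cells h5 h6 h7
    (fun M _ hR hn hfree => c025_core_nine_eight_of_caps'' M hR hn hfree hcap17 hcap16)
    (fun M _ hR hn hfree => c025_core_nine_nine_of_cap' M hR hn hfree hcap9)
    (fun M _ hR hn hfree => c025_core_nine_ten_of_cap'' M hR hn hfree hcap10) M p hp

end S1

end PercRepro
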